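import Literature.MathematicalPhysics.QuantumFieldTheory.Balaban1983to89.B5Prop11Plancherel
import Literature.MathematicalPhysics.QuantumFieldTheory.Balaban1983to89.Beta.VectorTailsPt
import HarnessLib

/-!
# Bloch sectors: a BLOCK-TRANSLATION-COVARIANT operator on the fine torus is BLOCK-DIAGONAL over the coarse
# momenta after the torus DFT and the coset reindexing `B5Prop11Plancherel.blockEquiv` (square and rectangular)

Width seat `ym3-torus-px16` (gen 20); `--kind proof --supports stmt-QuantumFields-20520 --as helper`, count-neutral,
DEFINITION-FREE (0 `def`, 0 `instance`, 0 `notation`, default heartbeats).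

Bears on crux stmt-QuantumFields-20520 `FluctuationComparisonRegPrIntL`, LINE `semiclassical_s2beta`, registered
stub GAP♯∘ `stub_uniformFibreGapOrbit` through the depth-uniform flat letter `hFlat` (UV3-NODE §53–§54), along
the SPECTRAL road (px20 g18, UV3-NODE §53.10 «Bloch reduction»).  Companion of
`…S2BetaBlochFloorOfBlocks.floor_of_blocks` (the abstract Plancherel floor), which CONSUMES hypotheses of the
shape `reindex e e (U A U^*) = blockDiagonal Ab` ∕ `reindex e′ e (U′ C U^*) = blockDiagonal Cb`.  This file
SUPPLIES them for the one structural reason §53.10 (1) names: the operators of `hFlat`'s linear core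
(`d₁†d₁`, the `m`-fold comb functionals `Q_m`, the residual-gauge pin projector) commute with the BLOCK
translations `x ↦ x + n·e_ν` of the fine torus `Π_ν ℤ∕(n·M_ν)` (`n = L^m` fine sites per block, `M_ν` blocks),
and THAT ALONE makes `F T F^*` vanish between different coarse momenta `q ≠ q′ ∈ Tor M`, i.e. block-diagonal
along `blockEquiv : Tor (n·M) × Fin d ≃ ((Fin d → Fin n) × Fin d) × Tor M` — the Bloch sectors ARE the cosets
`p = p′ + l` of [Balaban1984PropagatorsI] (1.31)∕(1.83).

What is proved (Mathlib objects + lit `B5Prop11Plancherel`'s `dft`∕`dftV`∕`shiftM`∕`unitVec`∕`emb`∕`blockEquiv` and lit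
`Beta.VectorTailsPt.dftV_mul_shiftM_pow` (whose §8 proves the CONVERSE direction for B5's `𝒢`);
no new definition; block translation in direction `ν` = `shiftM (fine n M) ν ^ n`):
* §1 `star_dftV_mul_diagonal_pow` (`U^* diag(χ_ν^n) = S_ν^n U^*`, adjoint of lit
  `Beta.VectorTailsPt.dftV_mul_shiftM_pow`), `stdAddChar_fine_pow_emb` (ON THE COSET `p = emb ((k, μ), q)` the block-translation
  multiplier `χ_ν(p)^n` IS the coarse character `e^{2πi q_ν∕M_ν}` — independent of the offset `k`),
  `exists_stdAddChar_ne_of_ne` (coarse characters separate coarse momenta, `ZMod.injective_stdAddChar`).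
* §2 ★★`conj_apply_eq_zero_of_blockCovariant` + ★★`reindex_conj_eq_blockDiagonal_of_blockCovariant`: if
  `T * S_ν^n = S_ν^n * T` for every `ν` then `reindex blockEquiv blockEquiv (U T U^*) = blockDiagonal (fun q => …)`
  with the EXPLICIT blocks `fun q a b => (U T U^*) (emb (a, q)) (emb (b, q))` (square case: the forms `A`, `P` of
  `floor_of_blocks`).
* §3 ★★`reindex_conj_eq_blockDiagonal_of_blockCovariant_rect`: the RECTANGULAR case for a constraint
  `C : (Tor M × Fin d) ← (Tor (n·M) × Fin d)` from fine vector fields to coarse vector fields (one constraint row per coarse site and direction — the three comb functionals of §53.10) with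
  `C * S_ν^n(fine) = S_ν(coarse) * C`: `reindex (prodComm) blockEquiv (U_M C U_fine^*)` is block-diagonal over
  `Tor M` with blocks `Fin d × ((Fin d → Fin n) × Fin d)` (the constraint `C` of `floor_of_blocks`, `U′ := dftV M`).
So for (B3) the remaining work per operator is ONLY to check block-translation covariance (a commutation with a
permutation matrix) and then to estimate the explicit finite-dimensional blocks sector by sector.

HONEST: finite-dimensional linear algebra over the characters of `ℤ∕N`; NOTHING of Bałaban's analysis is asserted
or proved; `hFlat`, GAP♯∘ (v11.4), S2β, crux 20520 and `YM3TorusSU2` are NOT proved; no registered stub is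
closed; rung R3 = SU(2) YM₃ on T³ at fixed lattice data — NOT d = 4, NOT infinite volume, NOT a mass gap, NOT
Clay; the Yang–Mills mass gap is NOT proved.  Sorry-free, axioms standard.

References: [Balaban1984PropagatorsI] (1.29), (1.31) p.23, (1.83) p.31 (coset decomposition `p = p′ + l`,
fibrewise reading of the averaging∕propagator operators); [Balaban1984PropagatorsII] (1.33).
-/

set_option autoImplicit false

open scoped BigOperators Matrix ComplexConjugate
open Finset Complex Matrix

namespace Summit.QuantumFields.YangMills.Theorems.FluctuationComparisonRegPrIntLS2BetaBlochBlocksOfCovariant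

open Literature.MathematicalPhysics.QuantumFieldTheory.Balaban1983to89.B5Prop11Plancherel
open Literature.MathematicalPhysics.QuantumFieldTheory.Balaban1983to89.Beta.VectorTailsPt (dftV_mul_shiftM_pow)

/-! ## §1. The block-translation multiplier and its value on the cosets -/

section Multiplier

variable {d : ℕ} (N : Fin d → ℕ) [hN : ∀ μ, NeZero (N μ)]

/-- `U^* diag(χ_ν^n) = S_ν^n U^*` — the adjoint of lit `Beta.VectorTailsPt.dftV_mul_shiftM_pow`
(`U S_ν^n = diag(χ_ν(p)^n) U`: the `n`-fold translation in direction `ν` is the Fourier multiplier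
`e^{2πi n p_ν∕N_ν}`). [folklore] -/
theorem star_dftV_mul_diagonal_pow (ν : Fin d) (n : ℕ) :
    star (dftV N) * Matrix.diagonal (fun i : Tor N × Fin d => (ZMod.stdAddChar (N := N ν)) (i.1 ν) ^ n)
      = shiftM N ν ^ n * star (dftV N) := by
  have h := dftV_mul_shiftM_pow N ν n
  have hU := star_dftV_mul N
  have hU' := dftV_mul_star N
  calc star (dftV N) * Matrix.diagonal (fun i : Tor N × Fin d => (ZMod.stdAddChar (N := N ν)) (i.1 ν) ^ n)
        = star (dftV N) * Matrix.diagonal (fun i : Tor N × Fin d => (ZMod.stdAddChar (N := N ν)) (i.1 ν) ^ n)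
            * (dftV N * star (dftV N)) := by rw [hU', Matrix.mul_one]
    _ = star (dftV N) * (Matrix.diagonal (fun i : Tor N × Fin d => (ZMod.stdAddChar (N := N ν)) (i.1 ν) ^ n)
            * dftV N) * star (dftV N) := by simp only [Matrix.mul_assoc]
    _ = star (dftV N) * (dftV N * shiftM N ν ^ n) * star (dftV N) := by rw [h]
    _ = shiftM N ν ^ n * star (dftV N) := by
          rw [← Matrix.mul_assoc, hU, Matrix.one_mul]

end Multiplier

section Coset

variable {d : ℕ} (n : ℕ) [NeZero n] (M : Fin d → ℕ) [hM : ∀ μ, NeZero (M μ)]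

/-- ON THE COSET the block-translation multiplier is the COARSE character: for the fine momentum
`p = emb ((k, μ), q)` (`p_ν = v(q_ν) + M_ν k_ν mod n M_ν`), `χ^{fine}_ν(p)^n = e^{2πi q_ν∕M_ν}` — independent of
the offset `k` (this is why block translations see only the Bloch sector `q`). [folklore] -/
theorem stdAddChar_fine_pow_emb (k : Fin d → Fin n) (μ : Fin d) (q : Tor M) (ν : Fin d) :
    (ZMod.stdAddChar (N := fine n M ν)) ((emb n M ((k, μ), q)).1 ν) ^ n
      = (ZMod.stdAddChar (N := M ν)) (q ν) := by
  have hMν : (M ν : ℂ) ≠ 0 := by exact_mod_cast NeZero.ne (M ν)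
  have hn : (n : ℂ) ≠ 0 := by exact_mod_cast NeZero.ne n
  have hq : (((q ν).valMinAbs : ℤ) : ZMod (M ν)) = q ν := ZMod.coe_valMinAbs (q ν)
  conv_rhs => rw [← hq]
  unfold emb
  simp only
  rw [ZMod.stdAddChar_coe, ZMod.stdAddChar_coe, ← Complex.exp_nat_mul]
  have hsplit : (n : ℂ) * (2 * Real.pi * I * (((q ν).valMinAbs + (M ν : ℤ) * ((k ν : ℕ) : ℤ) : ℤ) : ℂ)
        / ((fine n M ν : ℕ) : ℂ))
      = 2 * Real.pi * I * (((q ν).valMinAbs : ℤ) : ℂ) / (M ν : ℂ) + ((k ν : ℕ) : ℂ) * (2 * Real.pi * I) := by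
    simp only [fine]
    push_cast
    field_simp
  rw [hsplit, Complex.exp_add, Complex.exp_nat_mul_two_pi_mul_I, mul_one]

/-- coarse characters SEPARATE coarse momenta: `q ≠ q′ ⟹ ∃ ν, e^{2πi q_ν∕M_ν} ≠ e^{2πi q′_ν∕M_ν}`. [folklore] -/
theorem exists_stdAddChar_ne_of_ne {q q' : Tor M} (h : q ≠ q') :
    ∃ ν, (ZMod.stdAddChar (N := M ν)) (q ν) ≠ (ZMod.stdAddChar (N := M ν)) (q' ν) := by
  obtain ⟨ν, hν⟩ := Function.ne_iff.mp h
  exact ⟨ν, fun h' => hν (ZMod.injective_stdAddChar h')⟩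

end Coset

/-! ## §2. Square case: block-translation covariance ⟹ block-diagonal over the coarse momenta -/

section Square

variable {d : ℕ} (n : ℕ) [NeZero n] (M : Fin d → ℕ) [hM : ∀ μ, NeZero (M μ)]

/-- entrywise commutation with a diagonal multiplier: if `X D = D X` with `D = diag w`, then
`X i j = 0` whenever `w i ≠ w j`. [folklore] -/
theorem apply_eq_zero_of_commute_diagonal {ι : Type*} [Fintype ι] [DecidableEq ι] (X : Matrix ι ι ℂ)
    (w : ι → ℂ) (h : X * Matrix.diagonal w = Matrix.diagonal w * X) {i j : ι} (hw : w i ≠ w j) : X i j = 0 := by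
  have h1 := congrFun (congrFun h i) j
  rw [Matrix.mul_diagonal, Matrix.diagonal_mul] at h1
  have h2 : X i j * (w j - w i) = 0 := by rw [mul_sub, h1]; ring
  rcases mul_eq_zero.mp h2 with h3 | h3
  · exact h3
  · exact absurd (sub_eq_zero.mp h3).symm hw

/-- ★★ VANISHING BETWEEN SECTORS: if `T` commutes with every block translation `S_ν^n` of the fine vector fields,
then `(U T U^*) (emb (a, q)) (emb (b, q′)) = 0` for `q ≠ q′`. [folklore] -/
theorem conj_apply_eq_zero_of_blockCovariant
    (T : Matrix (Tor (fine n M) × Fin d) (Tor (fine n M) × Fin d) ℂ)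
    (hT : ∀ ν, T * shiftM (fine n M) ν ^ n = shiftM (fine n M) ν ^ n * T)
    (a b : (Fin d → Fin n) × Fin d) {q q' : Tor M} (hq : q ≠ q') :
    (dftV (fine n M) * T * star (dftV (fine n M))) (emb n M (a, q)) (emb n M (b, q')) = 0 := by
  obtain ⟨ν, hν⟩ := exists_stdAddChar_ne_of_ne M hq
  set U := dftV (fine n M) with hUdef
  set w : Tor (fine n M) × Fin d → ℂ := fun i => (ZMod.stdAddChar (N := fine n M ν)) (i.1 ν) ^ n with hw
  -- `X D = D X` for `X = U T U^*`, `D = diag w`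
  have hcomm : (U * T * star U) * Matrix.diagonal w = Matrix.diagonal w * (U * T * star U) := by
    calc (U * T * star U) * Matrix.diagonal w = U * T * (star U * Matrix.diagonal w) := by
          simp only [Matrix.mul_assoc]
      _ = U * T * (shiftM (fine n M) ν ^ n * star U) := by rw [hw, hUdef, star_dftV_mul_diagonal_pow]
      _ = U * (T * shiftM (fine n M) ν ^ n) * star U := by simp only [Matrix.mul_assoc]
      _ = U * (shiftM (fine n M) ν ^ n * T) * star U := by rw [hT ν]
      _ = (U * shiftM (fine n M) ν ^ n) * T * star U := by simp only [Matrix.mul_assoc]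
      _ = (Matrix.diagonal w * U) * T * star U := by rw [hUdef, hw, dftV_mul_shiftM_pow]
      _ = Matrix.diagonal w * (U * T * star U) := by simp only [Matrix.mul_assoc]
  refine apply_eq_zero_of_commute_diagonal _ w hcomm ?_
  obtain ⟨k, μ⟩ := a
  obtain ⟨k', μ'⟩ := b
  rw [hw]
  simp only
  rw [stdAddChar_fine_pow_emb, stdAddChar_fine_pow_emb]
  exact hν

/-- ★★ BLOCK-TRANSLATION COVARIANCE ⟹ COSET BLOCK-DIAGONAL (square case; the `hA`∕`hP` hypotheses of
`…S2BetaBlochFloorOfBlocks.floor_of_blocks` with `U := dftV`, `e := blockEquiv`, block index `Tor M`): if `T`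
commutes with every block translation `S_ν^n`, then along `blockEquiv` the conjugated operator `U T U^*` is
block-diagonal over the coarse momenta with the EXPLICIT blocks `T̂_q (a, b) = (U T U^*) (emb (a,q)) (emb (b,q))`.
[folklore] -/
theorem reindex_conj_eq_blockDiagonal_of_blockCovariant
    (T : Matrix (Tor (fine n M) × Fin d) (Tor (fine n M) × Fin d) ℂ)
    (hT : ∀ ν, T * shiftM (fine n M) ν ^ n = shiftM (fine n M) ν ^ n * T) :
    Matrix.reindex (blockEquiv n M) (blockEquiv n M) (dftV (fine n M) * T * star (dftV (fine n M)))
      = Matrix.blockDiagonal (fun q : Tor M => fun a b : (Fin d → Fin n) × Fin d =>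
          (dftV (fine n M) * T * star (dftV (fine n M))) (emb n M (a, q)) (emb n M (b, q))) := by
  ext ⟨a, q⟩ ⟨b, q'⟩
  rw [Matrix.reindex_apply, Matrix.submatrix_apply, blockEquiv_symm_apply, blockEquiv_symm_apply,
    Matrix.blockDiagonal_apply']
  split_ifs with h
  · subst h
    rfl
  · exact conj_apply_eq_zero_of_blockCovariant n M T hT a b h

end Square

/-! ## §3. Rectangular case: a block-covariant constraint from fine vector fields to coarse fields -/

section Rect

variable {d : ℕ} (n : ℕ) [NeZero n] (M : Fin d → ℕ) [hM : ∀ μ, NeZero (M μ)]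

/-- rectangular entrywise commutation: if `Y D = D′ Y` with `D = diag w` (columns), `D′ = diag w′` (rows), then
`Y r j = 0` whenever `w′ r ≠ w j`. [folklore] -/
theorem apply_eq_zero_of_intertwine_diagonal {ρ ι : Type*} [Fintype ρ] [DecidableEq ρ] [Fintype ι]
    [DecidableEq ι] (Y : Matrix ρ ι ℂ) (w : ι → ℂ) (w' : ρ → ℂ)
    (h : Y * Matrix.diagonal w = Matrix.diagonal w' * Y) {r : ρ} {j : ι} (hw : w' r ≠ w j) : Y r j = 0 := by
  have h1 := congrFun (congrFun h r) j
  rw [Matrix.mul_diagonal, Matrix.diagonal_mul] at h1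
  have h2 : Y r j * (w j - w' r) = 0 := by rw [mul_sub, h1]; ring
  rcases mul_eq_zero.mp h2 with h3 | h3
  · exact h3
  · exact absurd (sub_eq_zero.mp h3).symm hw

/-- the coarse torus's own `d`-component DFT intertwines the coarse unit translation with the coarse character
(lit `dftV_mul_shiftM` read at `N := M`): `U_M^* diag(χ_ν(q)) = S_ν U_M^*`. [folklore] -/
theorem star_dftV_mul_diagonal_coarse (ν : Fin d) :
    star (dftV M) * Matrix.diagonal (fun r : Tor M × Fin d => (ZMod.stdAddChar (N := M ν)) (r.1 ν))
      = shiftM M ν * star (dftV M) := by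
  have h := star_dftV_mul_diagonal_pow M ν 1
  simpa only [pow_one] using h

/-- ★★ VANISHING BETWEEN SECTORS (rectangular): if `C` maps fine vector fields to coarse `d`-component fields
with `C * S_ν^n(fine) = S_ν(coarse) * C` for every `ν`, then `(U_M C U_fine^*) ((q′, c)) (emb (b, q)) = 0`
for `q′ ≠ q`. [folklore] -/
theorem conj_apply_eq_zero_of_blockCovariant_rect
    (C : Matrix (Tor M × Fin d) (Tor (fine n M) × Fin d) ℂ)
    (hC : ∀ ν, C * shiftM (fine n M) ν ^ n = shiftM M ν * C)
    (c : Fin d) (b : (Fin d → Fin n) × Fin d) {q' q : Tor M} (hq : q' ≠ q) :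
    (dftV M * C * star (dftV (fine n M))) (q', c) (emb n M (b, q)) = 0 := by
  obtain ⟨ν, hν⟩ := exists_stdAddChar_ne_of_ne M hq
  set U := dftV (fine n M) with hUdef
  set V := dftV M with hVdef
  set w : Tor (fine n M) × Fin d → ℂ := fun i => (ZMod.stdAddChar (N := fine n M ν)) (i.1 ν) ^ n with hw
  set w' : Tor M × Fin d → ℂ := fun r => (ZMod.stdAddChar (N := M ν)) (r.1 ν) with hw'
  have hV1 : V * shiftM M ν = Matrix.diagonal w' * V := by
    rw [hVdef, hw', dftV_mul_shiftM]
  have hcomm : (V * C * star U) * Matrix.diagonal w = Matrix.diagonal w' * (V * C * star U) := by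
    calc (V * C * star U) * Matrix.diagonal w = V * C * (star U * Matrix.diagonal w) := by
          simp only [Matrix.mul_assoc]
      _ = V * C * (shiftM (fine n M) ν ^ n * star U) := by rw [hw, hUdef, star_dftV_mul_diagonal_pow]
      _ = V * (C * shiftM (fine n M) ν ^ n) * star U := by simp only [Matrix.mul_assoc]
      _ = V * (shiftM M ν * C) * star U := by rw [hC ν]
      _ = (V * shiftM M ν) * C * star U := by simp only [Matrix.mul_assoc]
      _ = (Matrix.diagonal w' * V) * C * star U := by rw [hV1]
      _ = Matrix.diagonal w' * (V * C * star U) := by simp only [Matrix.mul_assoc]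
  refine apply_eq_zero_of_intertwine_diagonal _ w w' hcomm ?_
  obtain ⟨k, μ⟩ := b
  rw [hw, hw']
  simp only
  rw [stdAddChar_fine_pow_emb]
  exact hν

/-- ★★ BLOCK-TRANSLATION COVARIANCE ⟹ COSET BLOCK-DIAGONAL (rectangular case; the `hC` hypothesis of
`…S2BetaBlochFloorOfBlocks.floor_of_blocks` with `U′ := dftV M` on the coarse `d`-component fields,
`e′ := Equiv.prodComm`, `e := blockEquiv`): if `C * S_ν^n(fine) = S_ν(coarse) * C` for every `ν`, then
`reindex prodComm blockEquiv (U_M C U_fine^*)` is block-diagonal over `Tor M` with the explicit blocks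
`Ĉ_q (c, b) = (U_M C U_fine^*) ((q, c)) (emb (b, q))`. [folklore] -/
theorem reindex_conj_eq_blockDiagonal_of_blockCovariant_rect
    (C : Matrix (Tor M × Fin d) (Tor (fine n M) × Fin d) ℂ)
    (hC : ∀ ν, C * shiftM (fine n M) ν ^ n = shiftM M ν * C) :
    Matrix.reindex (Equiv.prodComm (Tor M) (Fin d)) (blockEquiv n M)
        (dftV M * C * star (dftV (fine n M)))
      = Matrix.blockDiagonal (fun q : Tor M => fun (c : Fin d) (b : (Fin d → Fin n) × Fin d) =>
          (dftV M * C * star (dftV (fine n M))) (q, c) (emb n M (b, q))) := by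
  ext ⟨c, q'⟩ ⟨b, q⟩
  rw [Matrix.reindex_apply, Matrix.submatrix_apply, blockEquiv_symm_apply, Equiv.prodComm_symm,
    Equiv.prodComm_apply, Prod.swap_prod_mk, Matrix.blockDiagonal_apply']
  split_ifs with h
  · subst h
    rfl
  · exact conj_apply_eq_zero_of_blockCovariant_rect n M C hC c b h

end Rect

end Summit.QuantumFields.YangMills.Theorems.FluctuationComparisonRegPrIntLS2BetaBlochBlocksOfCovariant
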